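import Summits.Ventures.PercRepro.RankLevelSetSkewConv
import Mathlib.Data.Nat.Choose.Vandermonde

/-! # RankLevelSetNormSkew — THE NORMALIZED CUMULATIVE SKEW (THE NORMALIZED HALF RULE): THE CONE, ITS MONOTONICITY
IN THE PARAMETER, THE WEIGHTED SEQUENCES, AND THE CONDITIONING IDENTITY (night-1 g31; dossier §43)

For `a : ℕ → ℕ` and a parameter `N`, `NormSkew a N` («the normalized half rule») says that the normalized sequence
`a i / C(N, i)` is skewed right about `N/2`: `a i · C(N, j) ≤ a j · C(N, i)` for all `i < j` with `i + j ≤ N`.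
It is the normalized form of g30's cumulative skew `Skew a N` (`RankLevelSetSkewConv`), which it implies
(`normSkew_skew`: the binomials increase towards the middle); it is a cone (`normSkew_add`, `normSkew_sum`) and
it is monotone in the parameter (`normSkew_mono`: `C(N, i)/C(N, j)` grows as `N` shrinks). THE WEIGHTED SEQUENCES
`(wt a N p) x = a x · C(N − x, p − x)` (`x ≤ p ≤ N`) are the sequences that appear when a random `k`-subset of
`A ⊔ B` (`#A = N`) is conditioned on its union `U` with a second disjoint random subset, `p = #(U ∩ A)`: they are
(unnormalized) skewed about `p/2` (**`skew_wt`**). THE CONDITIONING IDENTITY (**`conv_mul_choose_eq_sum_wt`**):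
for `a` supported on `[0, N₁]`, `b` on `[0, N₂]` and `i + j ≤ N₁ + N₂`,
`(a ⋆ b) i · C(N₁ + N₂ − i, j) = Σ_{p ≤ i + j} (wt a N₁ p ⋆ wt b N₂ (i + j − p)) i`
(Vandermonde inside each term, `sum_wt_choose_eq`). `RankLevelSetNormSkewConv` turns it into the theorem
`NormSkew a N₁ → NormSkew b N₂ → NormSkew (a ⋆ b) (N₁ + N₂)`. Every declaration has a docstring; imports: the
cell's `RankLevelSetSkewConv` and Mathlib only. Axioms: standard. -/

namespace PercRepro

namespace SkewConv

open Finset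

/-! ## The normalized skew -/

/-- **The normalized cumulative skew** (the normalized half rule): `a i / C(N, i) ≤ a j / C(N, j)` whenever `i < j`
and `i + j ≤ N`, written cross-multiplied. -/
def NormSkew (a : ℕ → ℕ) (N : ℕ) : Prop :=
  ∀ i j : ℕ, i < j → i + j ≤ N → a i * N.choose j ≤ a j * N.choose i

/-- **Binomials increase towards the middle**: `C(n, i) ≤ C(n, j)` for `i ≤ j` with `i + j ≤ n`. -/
lemma choose_le_choose_add_le {n i j : ℕ} (hij : i ≤ j) (h : i + j ≤ n) : n.choose i ≤ n.choose j := by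
  have chain : ∀ a s : ℕ, a + s ≤ n / 2 → n.choose a ≤ n.choose (a + s) := by
    intro a s
    induction s with
    | zero => intro _; exact le_rfl
    | succ s ih =>
      intro hs
      rw [← Nat.add_assoc]
      exact (ih (by omega)).trans (Nat.choose_le_succ_of_lt_half_left (by omega))
  rcases le_or_gt j (n / 2) with hj | hj
  · have := chain i (j - i) (by omega)
    rwa [Nat.add_sub_cancel' hij] at this
  · have hjn : j ≤ n := by omega
    rw [← Nat.choose_symm hjn]
    have := chain i (n - j - i) (by omega)
    rwa [Nat.add_sub_cancel' (by omega : i ≤ n - j)] at this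

/-- **The normalized skew implies the cumulative skew** (`C(N, i) ≤ C(N, j)` on the compared pairs). -/
lemma normSkew_skew {a : ℕ → ℕ} {N : ℕ} (h : NormSkew a N) : Skew a N := by
  intro i j hij hR
  have h1 := h i j hij hR
  have h2 : N.choose i ≤ N.choose j := choose_le_choose_add_le hij.le hR
  have hpos : 0 < N.choose j := Nat.choose_pos (by omega)
  exact Nat.le_of_mul_le_mul_right (h1.trans (Nat.mul_le_mul_left _ h2)) hpos

/-- **The ratio `C(N, j)/C(N', j)` is nondecreasing in `j`** for `N' ≤ N` (one step, cross-multiplied). -/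
lemma chooseRatio_succ {N N' j : ℕ} (h : N' ≤ N) :
    N.choose j * N'.choose (j + 1) ≤ N.choose (j + 1) * N'.choose j := by
  have h1 := Nat.choose_succ_right_eq N j
  have h2 := Nat.choose_succ_right_eq N' j
  refine Nat.le_of_mul_le_mul_right (c := j + 1) ?_ (Nat.succ_pos j)
  calc N.choose j * N'.choose (j + 1) * (j + 1) = N.choose j * (N'.choose (j + 1) * (j + 1)) := by ring
    _ = N.choose j * (N'.choose j * (N' - j)) := by rw [h2]
    _ ≤ N.choose j * (N'.choose j * (N - j)) := by
        apply Nat.mul_le_mul_left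
        apply Nat.mul_le_mul_left
        omega
    _ = N.choose j * (N - j) * N'.choose j := by ring
    _ = N.choose (j + 1) * (j + 1) * N'.choose j := by rw [h1]
    _ = N.choose (j + 1) * N'.choose j * (j + 1) := by ring

/-- **The ratio `C(N, j)/C(N', j)` is nondecreasing in `j`** for `N' ≤ N`, across a gap `i ≤ j ≤ N'`. -/
lemma chooseRatio_le {N N' i j : ℕ} (h : N' ≤ N) (hij : i ≤ j) (hj : j ≤ N') :
    N.choose i * N'.choose j ≤ N.choose j * N'.choose i := by
  obtain ⟨s, rfl⟩ := Nat.exists_eq_add_of_le hij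
  induction s with
  | zero => simp
  | succ s ih =>
    have ih' := ih (by omega) (by omega)
    rw [← Nat.add_assoc]
    have hstep := chooseRatio_succ (N := N) (N' := N') (j := i + s) h
    have hpos : 0 < N.choose (i + s) * N'.choose (i + s) :=
      Nat.mul_pos (Nat.choose_pos (by omega)) (Nat.choose_pos (by omega))
    refine Nat.le_of_mul_le_mul_right (c := N.choose (i + s) * N'.choose (i + s)) ?_ hpos
    calc N.choose i * N'.choose (i + s + 1) * (N.choose (i + s) * N'.choose (i + s))
        = (N.choose i * N'.choose (i + s)) * (N.choose (i + s) * N'.choose (i + s + 1)) := by ring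
      _ ≤ (N.choose (i + s) * N'.choose i) * (N.choose (i + s + 1) * N'.choose (i + s)) :=
          Nat.mul_le_mul ih' hstep
      _ = N.choose (i + s + 1) * N'.choose i * (N.choose (i + s) * N'.choose (i + s)) := by ring

/-- **The normalized skew is monotone in the parameter**: `NormSkew a N → NormSkew a N'` for `N' ≤ N`. -/
lemma normSkew_mono {a : ℕ → ℕ} {N N' : ℕ} (h : NormSkew a N) (hN : N' ≤ N) : NormSkew a N' := by
  intro i j hij hR
  have h1 := h i j hij (hR.trans hN)
  have h2 : N.choose i * N'.choose j ≤ N.choose j * N'.choose i := chooseRatio_le hN hij.le (by omega)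
  have hpos : 0 < N.choose i := Nat.choose_pos (by omega)
  refine Nat.le_of_mul_le_mul_left (c := N.choose i) ?_ hpos
  calc N.choose i * (a i * N'.choose j) = a i * (N.choose i * N'.choose j) := by ring
    _ ≤ a i * (N.choose j * N'.choose i) := Nat.mul_le_mul_left _ h2
    _ = (a i * N.choose j) * N'.choose i := by ring
    _ ≤ (a j * N.choose i) * N'.choose i := Nat.mul_le_mul_right _ h1
    _ = N.choose i * (a j * N'.choose i) := by ring

/-- The normalized skew is closed under pointwise sums. -/
lemma normSkew_add {v w : ℕ → ℕ} {N : ℕ} (hv : NormSkew v N) (hw : NormSkew w N) :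
    NormSkew (fun k => v k + w k) N := by
  intro i j hij hR
  have := Nat.add_le_add (hv i j hij hR) (hw i j hij hR)
  simp only [Nat.add_mul] at this ⊢
  exact this

/-- The normalized skew is closed under finite sums. -/
lemma normSkew_sum {ι : Type*} (s : Finset ι) (f : ι → ℕ → ℕ) {N : ℕ} (h : ∀ x ∈ s, NormSkew (f x) N) :
    NormSkew (fun k => ∑ x ∈ s, f x k) N := by
  classical
  induction s using Finset.induction_on with
  | empty => intro i j _ _; simp
  | insert y s hy ih =>
    have h1 : NormSkew (fun k => f y k + ∑ x ∈ s, f x k) N :=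
      normSkew_add (h y (Finset.mem_insert_self y s)) (ih fun x hx => h x (Finset.mem_insert_of_mem hx))
    intro i j hij hR
    have := h1 i j hij hR
    simpa [Finset.sum_insert hy] using this

/-- The zero sequence is normalized-skew. -/
lemma normSkew_zero (N : ℕ) : NormSkew (fun _ => 0) N := fun _ _ _ _ => by simp

/-- The normalized skew only depends on the values at indices `≤ N`. -/
lemma normSkew_congr {v w : ℕ → ℕ} {N : ℕ} (h : NormSkew v N) (hvw : ∀ k, k ≤ N → v k = w k) :
    NormSkew w N := by
  intro i j hij hR
  rw [← hvw i (by omega), ← hvw j (by omega)]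
  exact h i j hij hR

/-! ## The weighted sequences `x ↦ a x · C(N − x, p − x)` -/

/-- **The weighted sequence** `(wt a N p) x = a x · C(N − x, N − p)` (`= a x · C(N − x, p − x)` for `x ≤ p ≤ N`,
`0` for `x > p`), and `0` when `p > N`. -/
def wt (a : ℕ → ℕ) (N p : ℕ) (x : ℕ) : ℕ := if p ≤ N then a x * (N - x).choose (N - p) else 0

/-- **The weighted sequence of a normalized-skew sequence is skewed about `p/2`**: `NormSkew a N → p ≤ N →`
`Skew (wt a N p) p`. -/
lemma skew_wt {a : ℕ → ℕ} {N p : ℕ} (ha : NormSkew a N) (hp : p ≤ N) : Skew (wt a N p) p := by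
  intro x x' hxx' hsum
  unfold wt
  rw [if_pos hp, if_pos hp]
  have hx'p : x' ≤ p := by omega
  have hxp : x ≤ p := by omega
  -- `C(N, p) · C(p, x) = C(N, x) · C(N − x, p − x)` and `C(N − x, p − x) = C(N − x, N − p)`
  have e1 : N.choose p * p.choose x = N.choose x * (N - x).choose (p - x) := Nat.choose_mul hxp
  have e1' : N.choose p * p.choose x' = N.choose x' * (N - x').choose (p - x') := Nat.choose_mul hx'p
  have s1 : (N - x).choose (N - p) = (N - x).choose (p - x) := by
    have := Nat.choose_symm (n := N - x) (k := p - x) (by omega)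
    rwa [show N - x - (p - x) = N - p by omega] at this
  have s1' : (N - x').choose (N - p) = (N - x').choose (p - x') := by
    have := Nat.choose_symm (n := N - x') (k := p - x') (by omega)
    rwa [show N - x' - (p - x') = N - p by omega] at this
  rw [s1, s1']
  have hna := ha x x' hxx' (by omega)
  have hcp : p.choose x ≤ p.choose x' := choose_le_choose_add_le hxx'.le hsum
  have hpos : 0 < N.choose x * N.choose x' :=
    Nat.mul_pos (Nat.choose_pos (by omega)) (Nat.choose_pos (by omega))
  refine Nat.le_of_mul_le_mul_right (c := N.choose x * N.choose x') ?_ hpos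
  calc a x * (N - x).choose (p - x) * (N.choose x * N.choose x')
      = a x * N.choose x' * (N.choose x * (N - x).choose (p - x)) := by ring
    _ = a x * N.choose x' * (N.choose p * p.choose x) := by rw [e1]
    _ ≤ a x' * N.choose x * (N.choose p * p.choose x) := Nat.mul_le_mul_right _ hna
    _ ≤ a x' * N.choose x * (N.choose p * p.choose x') := by
        apply Nat.mul_le_mul_left
        exact Nat.mul_le_mul_left _ hcp
    _ = a x' * N.choose x * (N.choose x' * (N - x').choose (p - x')) := by rw [e1']
    _ = a x' * (N - x').choose (p - x') * (N.choose x * N.choose x') := by ring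

/-! ## The conditioning identity -/

/-- **The inner Vandermonde identity** behind the conditioning: for `x ≤ i`, `x ≤ N₁`, `i − x ≤ N₂`,
`Σ_{p ≤ i + j} [p ≤ N₁]·C(N₁ − x, N₁ − p)·[i + j − p ≤ N₂]·C(N₂ − (i − x), N₂ − (i + j − p))
  = C((N₁ − x) + (N₂ − (i − x)), j)` (the terms with `p < x` or `p > x + j` vanish; `p = x + p'`). -/
lemma sum_wt_choose_eq {N₁ N₂ i j x : ℕ} (hxi : x ≤ i) (hx : x ≤ N₁) (hy : i - x ≤ N₂) :
    ∑ p ∈ range (i + j + 1),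
      (if p ≤ N₁ then (N₁ - x).choose (N₁ - p) else 0) *
        (if i + j - p ≤ N₂ then (N₂ - (i - x)).choose (N₂ - (i + j - p)) else 0) =
      (N₁ - x + (N₂ - (i - x))).choose j := by
  set f : ℕ → ℕ := fun p => (if p ≤ N₁ then (N₁ - x).choose (N₁ - p) else 0) *
        (if i + j - p ≤ N₂ then (N₂ - (i - x)).choose (N₂ - (i + j - p)) else 0) with hf
  have hvan : ∀ p, p ≤ i + j → p < x ∨ x + j < p → f p = 0 := by
    intro p hp hp'
    rcases hp' with hp' | hp'
    · simp only [hf]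
      split_ifs with h1 h2
      · rw [Nat.choose_eq_zero_of_lt (by omega), Nat.zero_mul]
      · simp
      · simp
      · simp
    · simp only [hf]
      split_ifs with h1 h2
      · rw [Nat.choose_eq_zero_of_lt (n := N₂ - (i - x)) (k := N₂ - (i + j - p)) (by omega), Nat.mul_zero]
      · simp
      · simp
      · simp
  have hsub : ∑ p ∈ range (i + j + 1), f p = ∑ p ∈ Ico x (x + j + 1), f p := by
    symm
    apply Finset.sum_subset
    · intro p hp
      rw [Finset.mem_Ico] at hp
      rw [Finset.mem_range]
      omega
    · intro p hp hp'
      rw [Finset.mem_range] at hp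
      rw [Finset.mem_Ico] at hp'
      exact hvan p (by omega) (by omega)
  change ∑ p ∈ range (i + j + 1), f p = _
  rw [hsub, Finset.sum_Ico_eq_sum_range, show x + j + 1 - x = j + 1 by omega, Nat.add_choose_eq,
    Finset.Nat.sum_antidiagonal_eq_sum_range_succ (fun u v => (N₁ - x).choose u * (N₂ - (i - x)).choose v)]
  refine Finset.sum_congr rfl fun p' hp' => ?_
  rw [Finset.mem_range] at hp'
  simp only [hf]
  by_cases h1 : x + p' ≤ N₁
  · rw [if_pos h1]
    have e1 : (N₁ - x).choose (N₁ - (x + p')) = (N₁ - x).choose p' := by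
      have := Nat.choose_symm (n := N₁ - x) (k := p') (by omega)
      rwa [show N₁ - x - p' = N₁ - (x + p') by omega] at this
    rw [e1]
    by_cases h2 : i + j - (x + p') ≤ N₂
    · rw [if_pos h2]
      have e2 : (N₂ - (i - x)).choose (N₂ - (i + j - (x + p'))) = (N₂ - (i - x)).choose (j - p') := by
        have := Nat.choose_symm (n := N₂ - (i - x)) (k := j - p') (by omega)
        rwa [show N₂ - (i - x) - (j - p') = N₂ - (i + j - (x + p')) by omega] at this
      rw [e2]
    · rw [if_neg h2, Nat.mul_zero, Nat.choose_eq_zero_of_lt (n := N₂ - (i - x)) (k := j - p') (by omega),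
        Nat.mul_zero]
  · rw [if_neg h1, Nat.zero_mul, Nat.choose_eq_zero_of_lt (n := N₁ - x) (k := p') (by omega), Nat.zero_mul]

/-- **The conditioning identity**: for `a` supported on `[0, N₁]`, `b` on `[0, N₂]` and `i + j ≤ N₁ + N₂`,
`(a ⋆ b) i · C(N₁ + N₂ − i, j) = Σ_{p ≤ i + j} (wt a N₁ p ⋆ wt b N₂ (i + j − p)) i`. -/
lemma conv_mul_choose_eq_sum_wt {a b : ℕ → ℕ} {N₁ N₂ : ℕ} (ha0 : ∀ x, N₁ < x → a x = 0)
    (hb0 : ∀ s, N₂ < s → b s = 0) (i j : ℕ) (hij : i + j ≤ N₁ + N₂) :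
    conv a b i * (N₁ + N₂ - i).choose j =
      ∑ p ∈ range (i + j + 1), conv (wt a N₁ p) (wt b N₂ (i + j - p)) i := by
  have key : ∀ x ∈ range (i + 1), a x * b (i - x) * (N₁ + N₂ - i).choose j =
      ∑ p ∈ range (i + j + 1), wt a N₁ p x * wt b N₂ (i + j - p) (i - x) := by
    intro x hx
    rw [Finset.mem_range] at hx
    by_cases hax : a x = 0
    · simp [hax, wt]
    by_cases hbx : b (i - x) = 0
    · simp [hbx, wt]
    have hxN : x ≤ N₁ := by
      by_contra h
      exact hax (ha0 x (by omega))
    have hyN : i - x ≤ N₂ := by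
      by_contra h
      exact hbx (hb0 _ (by omega))
    have hV := sum_wt_choose_eq (N₁ := N₁) (N₂ := N₂) (i := i) (j := j) (x := x) (by omega) hxN hyN
    rw [show N₁ - x + (N₂ - (i - x)) = N₁ + N₂ - i by omega] at hV
    rw [← hV, Finset.mul_sum]
    refine Finset.sum_congr rfl fun p _ => ?_
    unfold wt
    split_ifs <;> ring
  unfold conv
  rw [Finset.sum_comm, Finset.sum_mul]
  exact Finset.sum_congr rfl key

end SkewConv

end PercRepro
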